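import Literature.IUT.HodgeTheaters.GenuineFKitOfBadLocal
import Literature.IUT.HodgeTheaters.BadLocalFrobenioidOfKitsDTheta
import Literature.IUT.HodgeTheaters.BadLocalFrobenioidOfKitsBases
import Literature.IUT.HodgeTheaters.InitialThetaDataBadLocalFrobenioidProps
import Literature.IUT.HodgeTheaters.GoodLocalFrobenioidOfGaloisDdash
import Literature.AnabelianGeometry.SemiGraphs.TemperedGroups
import HarnessLib

/-!
# The bad-place slot of the genuine `ℱ`-kit: [IUTchI] Example 3.2 (iv)(v)(vi) READ AT THE MERGE RECORD
# `InitialThetaData.frobeniusBadAt B I x hx` (the dictionary entry of `GenuineFKitOfBadLocal.lean`, abc-iut-L5-t2 p496697)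

S. Mochizuki, *Inter-universal Teichmüller theory I*, kurims manuscript (May 2020), Example 3.2 (iv) p. 71 («`q_v ∈ 𝒪^▷_{K_v}`
… admits a `2l`-th root `q̲_v`», «`Φ_{𝒞⊢_v} := ℕ·log(q̲_v)|_{𝒟⊢_v}` … a `p_v`-adic Frobenioid `𝒞⊢_v`»), (v) pp. 72–73, (vi) p. 73 («(a)
`𝒟⊢_v ⊆ 𝒟_v` from `𝒟_v` [[AbsAnab] Lem. 1.3.8]; (b) `𝒟^Θ_v` from `𝒟_v`; (c) `𝒟⊢_v` (resp. `𝒟^Θ_v`) from `𝒞⊢_v` (resp. `𝒞^Θ_v`)»),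
Remark 3.2.2 p. 74 ([IUTchI] Ex 3.2 (vi) p.73) [claim: Mochizuki2012, status: disputed] (D-0012 claim key, series status DISPUTED —
PROOF-ONLY compositions; nothing of the series is asserted; no side is taken on [IUTchIII] Cor. 3.12).

PURPOSE (L5 BASE-MERGE RACE, abc-iut-L5-lead RULING #1 / #117; TOKEN EDIT v2.8 «Ex3.2(i–vi) → at-merge(p496697) mod I.m1/I.m2»):
the (S2) dictionary entry of the genuine `ℱ`-kit at a bad index `x` is
`D.frobeniusBadAt B I x hx = D.badLocalFrobenioidAt (placeBelow_mem_VFbad) (specAt) (primeAt) (primeAt_mem) (I.m2 x hx) (I.m1 x hx).Kt`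
(abc-iut-L5-t2's [IUTchI] Ex. 3.2 assembly p442528/p440826 fired on the kit's own `Π_{X̳̲_v̲} = (B x hx).H`, the tempered side
entering ONLY through the merge record `I : D.MergeInputs B`).  THIS FILE re-states, AT THAT DECL and BY NAME, the landed
genuine-datum theorems of the Ex. 3.2 family so that the re-pointed hub tokens cite decls over the merge record:
* (iv) data: `frobeniusBadAt_q` (`q_v̲`, `q̲_v̲` ARE the genuine Tate parameter at `w` and its `2l`-th root — `rfl`),
  `frobeniusBadAt_Cdash` (`𝒞⊢_v̲`, `τ⊢_v̲` ARE the genuine `badCdashAt`/`badTauDashAt` — `rfl`), `isFrobenioid_frobeniusBadAt_Cdash`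
  (`𝒞⊢_v̲` IS a Frobenioid of standard type, p444050), Rmk. 3.2.2 `nearlyAbsolutelyPrimitive_frobeniusBadAt` (F-1314 instance, p444050);
* (v): `isFrobenioid_frobeniusBadAt_CTheta` (`𝒞^Θ_v̲` over `𝒟^Θ_v̲` IS a Frobenioid of standard type), `isSlim_frobeniusBadAt_DTheta`;
* (vi)(c) UNCONDITIONAL: `basesFromC_frobeniusBadAt` (p442831 `basesFromC_badLocalFrobenioidAt` with `T := I.m2 x hx`);
* (vi)(a) mod {`hP` tempered, `hΔ` [AbsAnab] Lem. 1.3.8 shape}: `ddashFromD_frobeniusBadAt_of_forall_map_ker` (p489141), the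
  Galois-countability of `↥(B x hx).H ≤ Π_{C_F}` DISCHARGED from `I.geomTFG` (F-0240 ⇒ `secondCountableTopology_PiC_of_geomTFG`);
  `…_of_injective` (no covering); `…_of_isClosed` (`hP` discharged for a CLOSED avatar `H` by [SemiAnbd] Rmk. 3.1.1
  `IsTempered.of_profinite`, abc-iut-L3-t2);
* (vi)(b) mod {`hP`, `hΔ`, `hY`}: `dThetaFromD_frobeniusBadAt_of_forall_map_ker` (p491087); `…_of_isClosed`.
BINDER CENSUS: {`D`, `B`, `I`, `x`, `hx`} ∪ the displayed anabelian shapes {`hP` | `hH`, `hΔ`, `hY`, `hinj`} exactly as in the cited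
files; FACT unnamed 0; no definition, instance or notation; no `sorry`.  typed ≠ inhabited ≠ proved; nothing here asserts abc.
-/

noncomputable section

namespace Literature.IUT.HodgeTheaters

open CategoryTheory _root_.NumberField _root_.IsDedekindDomain Literature.NumberTheory.NumberFields
  Literature.AlgebraicGeometry.Frobenioids Literature.AlgebraicGeometry.Frobenioids.PadicFrd
  Literature.AnabelianGeometry.SemiGraphs Topology

variable {F K Fbar : Type} [Field F] [NumberField F] [Field K] [NumberField K] [Algebra F K]
  [Field Fbar] [Algebra F Fbar] [Algebra K Fbar] {E : WeierstrassCurve F}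
  [E.IsElliptic] {l : ℕ} {Pb : BadPlacePredicates K} (D : InitialThetaData F K Fbar E l Pb)
  (B : ∀ v, v ∈ D.indexCopyBad → D.BadPairAt v) (I : D.MergeInputs B) (x : D.IndexCopy) (hx : x ∈ D.indexCopyBad)

namespace InitialThetaData

/-! ### (iv) the genuine `q_v̲`, `q̲_v̲`, `𝒟⊢_v̲`, `𝒞⊢_v̲`, `τ⊢_v̲` at the merge record -/

/-- **(iv)** the `q_v`, `q̲_v` of the merge-record Frobenioid ARE the genuine Tate parameter of `E_K` at `w` and its `2l`-th root
(`qParamAt`/`qRootAt` at the place named by `x`, p442528). ([IUTchI] Ex 3.2 (iv) p.71) [claim: Mochizuki2012, status: disputed] -/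
theorem frobeniusBadAt_q [Fact (D.primeAt x (D.not_mem_arc_of_mem_bad hx)).Prime] :
    (D.frobeniusBadAt B I x hx).q =
        (haveI := D.liesOver_placeBelow x hx; haveI := D.isScalarTower
         D.qParamAt (D.placeBelow_mem_VFbad x hx) (D.specAt x _) (D.primeAt x _) (D.primeAt_mem x _)) ∧
      (D.frobeniusBadAt B I x hx).qroot = D.qRootAtIdx x hx :=
  ⟨rfl, rfl⟩

/-- **(iv)** the `𝒞⊢_v`, `τ⊢_v` of the merge-record Frobenioid ARE the genuine `badCdashAt`, `badTauDashAt` (monogenic [FrdII] Ex. 1.1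
(ii) Frobenioid of `ℕ·log_Φ(q̲_v̲)` over `𝓑(K_v̲)⁰` and the splittings of the associates of `q̲_v̲`, p442528) — NO input.
([IUTchI] Ex 3.2 (iv) p.71) [claim: Mochizuki2012, status: disputed] -/
theorem frobeniusBadAt_Cdash [Fact (D.primeAt x (D.not_mem_arc_of_mem_bad hx)).Prime] :
    (D.frobeniusBadAt B I x hx).Cdash =
        (haveI := D.liesOver_placeBelow x hx; haveI := D.isScalarTower
         D.badCdashAt (D.placeBelow_mem_VFbad x hx) (D.specAt x _) (D.primeAt x _) (D.primeAt_mem x _)) ∧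
      (D.frobeniusBadAt B I x hx).tauDashOf =
        (haveI := D.liesOver_placeBelow x hx; haveI := D.isScalarTower
         D.badTauDashAt (D.placeBelow_mem_VFbad x hx) (D.specAt x _) (D.primeAt x _) (D.primeAt_mem x _)) :=
  ⟨rfl, rfl⟩

/-- **(iv)** `𝒞⊢_v̲` of the merge record IS a Frobenioid, of standard type ([FrdII] Thm. 1.2 (i) for the monogenic datum; p444050
`badCdashAt_isFrobenioid` / `_isOfStandardType`). ([IUTchI] Ex 3.2 (iv) p.71) [claim: Mochizuki2012, status: disputed] -/
theorem isFrobenioid_frobeniusBadAt_Cdash [Fact (D.primeAt x (D.not_mem_arc_of_mem_bad hx)).Prime] :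
    PreFrobenioid.IsFrobenioid ((D.gvdAt x _).dashDatum (D.qRootAtIdx_not_isUnit x hx)).structureFunctor ∧
      (ModelFrobenioid.data ((D.gvdAt x _).dashDatum (D.qRootAtIdx_not_isUnit x hx)).Φ
        ((D.gvdAt x _).dashDatum (D.qRootAtIdx_not_isUnit x hx)).B
        ((D.gvdAt x _).dashDatum (D.qRootAtIdx_not_isUnit x hx)).divB).IsOfStandardType :=
  haveI := D.liesOver_placeBelow x hx
  haveI := D.isScalarTower
  ⟨D.badCdashAt_isFrobenioid (D.placeBelow_mem_VFbad x hx) (D.specAt x _) (D.primeAt x _) (D.primeAt_mem x _),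
    D.badCdashAt_isOfStandardType (D.placeBelow_mem_VFbad x hx) (D.specAt x _) (D.primeAt x _) (D.primeAt_mem x _)⟩

/-- **Remark 3.2.2 at the merge record** — «`N·Φ_{𝒞⊢_v}` is absolutely primitive»: abc-iut-f-194's F-1314 instance theorem read at the
genuine `𝒞⊢_v̲` (p444050 `nearlyAbsolutelyPrimitive_badCdashAt`). ([IUTchI] Rmk 3.2.2 p.74) [claim: Mochizuki2012, status: disputed] -/
theorem nearlyAbsolutelyPrimitive_frobeniusBadAt [Fact (D.primeAt x (D.not_mem_arc_of_mem_bad hx)).Prime] :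
    NearlyAbsolutelyPrimitive (Obj := CosetCat (D.GalAt x (D.not_mem_arc_of_mem_bad hx)))
      (fun A => MonoidHom.mrange (((D.gvdAt x _).dashDatum (D.qRootAtIdx_not_isUnit x hx)).phiGp A))
      (fun A => (((D.gvdAt x _).dashDatum (D.qRootAtIdx_not_isUnit x hx)).ordQpSubgroup A).toSubmonoid) :=
  haveI := D.liesOver_placeBelow x hx
  haveI := D.isScalarTower
  D.nearlyAbsolutelyPrimitive_badCdashAt (D.placeBelow_mem_VFbad x hx) (D.specAt x _) (D.primeAt x _) (D.primeAt_mem x _)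

/-! ### (v) `𝒞^Θ_v̲` over `𝒟^Θ_v̲` at the merge record -/

/-- **(v)** `𝒞^Θ_v̲ → F_Φ` of the merge record IS a Frobenioid of standard type over the FSM-type base `𝒟^Θ_v̲` (p444050
`thetaDatum_isFrobenioid` / `_isOfStandardType` for the group datum `I.m2 x hx`). ([IUTchI] Ex 3.2 (v) p.73) [claim: Mochizuki2012, status: disputed] -/
theorem isFrobenioid_frobeniusBadAt_CTheta [Fact (D.primeAt x (D.not_mem_arc_of_mem_bad hx)).Prime] :
    PreFrobenioid.IsFrobenioid ((I.m2 x hx).thetaDatum (D.gvdAt x _) (D.qRootAtIdx_not_isUnit x hx)).structureFunctor ∧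
      (ModelFrobenioid.data ((I.m2 x hx).thetaDatum (D.gvdAt x _) (D.qRootAtIdx_not_isUnit x hx)).Φ
        ((I.m2 x hx).thetaDatum (D.gvdAt x _) (D.qRootAtIdx_not_isUnit x hx)).B
        ((I.m2 x hx).thetaDatum (D.gvdAt x _) (D.qRootAtIdx_not_isUnit x hx)).divB).IsOfStandardType :=
  ⟨(I.m2 x hx).thetaDatum_isFrobenioid (D.gvdAt x _) (D.qRootAtIdx_not_isUnit x hx),
    (I.m2 x hx).thetaDatum_isOfStandardType (D.gvdAt x _) (D.qRootAtIdx_not_isUnit x hx)⟩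

/-- **(v)** `𝒟^Θ_v̲` of the merge record is slim (transport of the slimness of `𝓑(K_v̲)⁰`, [AbsAnab] Thm. 1.1.1 (ii) at `K_w`; p444050
`isSlim_badDThetaAt`). ([IUTchI] Ex 3.2 (v) p.72) [claim: Mochizuki2012, status: disputed] -/
theorem isSlim_frobeniusBadAt_DTheta [Fact (D.primeAt x (D.not_mem_arc_of_mem_bad hx)).Prime] :
    IsSlim (D.frobeniusBadAt B I x hx).DTheta :=
  isSlim_badDThetaAt (D.specAt x _) (D.primeAt x _) (D.primeAt_mem x (D.not_mem_arc_of_mem_bad hx)) (I.m2 x hx)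

/-! ### (vi)(c) UNCONDITIONAL, (vi)(a)(b) modulo the displayed anabelian shapes -/

/-- **(vi)(c) at the merge record — UNCONDITIONAL**: `𝒟⊢_v̲`, `𝒟^Θ_v̲` are reconstructible category-theoretically from `𝒞⊢_v̲`, `𝒞^Θ_v̲`
(p442831 `basesFromC_badLocalFrobenioidAt` with `T := I.m2 x hx`: [FrdI] Thm. 3.4 (v) with standard type, FSM-type and the slimness of
`𝓑(K_w)⁰` all kernel theorems). ([IUTchI] Ex 3.2 (vi) (c) p.73) [claim: Mochizuki2012, status: disputed] -/
theorem basesFromC_frobeniusBadAt [Fact (D.primeAt x (D.not_mem_arc_of_mem_bad hx)).Prime] :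
    (D.frobeniusBadAt B I x hx).BasesFromC :=
  haveI := D.liesOver_placeBelow x hx
  haveI := D.isScalarTower
  letI := (I.m1 x hx).catFv; letI := (I.m1 x hx).catFbirat; letI := (I.m1 x hx).catCv
  D.basesFromC_badLocalFrobenioidAt (D.placeBelow_mem_VFbad x hx) (D.specAt x _) (D.primeAt x _) (D.primeAt_mem x _)
    (I.m2 x hx) (I.m1 x hx).Kt

include I in
/-- The pair's profinite avatar `↥(B x hx).H ≤ Π_{C_F}` is Galois-countable, from FACT F-0240 in `I` ([AbsTopI] Prop. 2.2 ⇒ [IUTchI]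
Rmk. 2.5.3 (ii), abc-iut-L5-t16 `secondCountableTopology_PiC_of_geomTFG`). ([IUTchI] Rmk 2.5.3 (ii) p.59) [claim: Mochizuki2012, status: disputed] -/
theorem secondCountableTopology_badPair : SecondCountableTopology ↥(B x hx).H :=
  haveI := D.secondCountableTopology_PiC_of_geomTFG I.geomTFG
  TopologicalSpace.Subtype.secondCountableTopology ((B x hx).H : Set D.PiC)

/-- **(vi)(a) at the merge record** modulo {`hP`: `Π_{X̳̲_v̲}` tempered, `hΔ`: [AbsAnab] Lem. 1.3.8 in the unfolded shape for `aug`}: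
`𝒟⊢_v̲ ⊆ 𝒟_v̲` is reconstructible category-theoretically from `𝒟_v̲` (p489141 `ddashFromD_badLocalFrobenioidAt_of_forall_map_ker` with
`T := I.m2 x hx`; Galois-countability from `I.geomTFG`). ([IUTchI] Ex 3.2 (vi) (a) p.73) [claim: Mochizuki2012, status: disputed] -/
theorem ddashFromD_frobeniusBadAt_of_forall_map_ker [Fact (D.primeAt x (D.not_mem_arc_of_mem_bad hx)).Prime]
    (hP : IsTempered ↥(B x hx).H)
    (hΔ : ∀ φ : ↥(B x hx).H ≃ₜ* ↥(B x hx).H, (I.m2 x hx).aug.ker.map φ.toMulEquiv.toMonoidHom = (I.m2 x hx).aug.ker) :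
    (D.frobeniusBadAt B I x hx).DdashFromD :=
  haveI := D.liesOver_placeBelow x hx
  haveI := D.isScalarTower
  haveI := D.secondCountableTopology_badPair B I x hx
  letI := (I.m1 x hx).catFv; letI := (I.m1 x hx).catFbirat; letI := (I.m1 x hx).catCv
  D.ddashFromD_badLocalFrobenioidAt_of_forall_map_ker (D.placeBelow_mem_VFbad x hx) (D.specAt x _) (D.primeAt x _)
    (D.primeAt_mem x _) (I.m2 x hx) (I.m1 x hx).Kt hP hΔ

/-- **(vi)(a) at the merge record for a group datum with injective `aug`** (no covering), modulo `hP` only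
(p489141 `…_of_injective`). ([IUTchI] Ex 3.2 (vi) (a) p.73) [claim: Mochizuki2012, status: disputed] -/
theorem ddashFromD_frobeniusBadAt_of_injective [Fact (D.primeAt x (D.not_mem_arc_of_mem_bad hx)).Prime]
    (hP : IsTempered ↥(B x hx).H) (hinj : Function.Injective (I.m2 x hx).aug) :
    (D.frobeniusBadAt B I x hx).DdashFromD :=
  haveI := D.liesOver_placeBelow x hx
  haveI := D.isScalarTower
  haveI := D.secondCountableTopology_badPair B I x hx
  letI := (I.m1 x hx).catFv; letI := (I.m1 x hx).catFbirat; letI := (I.m1 x hx).catCv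
  D.ddashFromD_badLocalFrobenioidAt_of_injective (D.placeBelow_mem_VFbad x hx) (D.specAt x _) (D.primeAt x _)
    (D.primeAt_mem x _) (I.m2 x hx) (I.m1 x hx).Kt hP hinj

/-- A CLOSED profinite avatar `Π_{X̳̲_v̲} = (B x hx).H ≤ Π_{C_F}` is tempered ([SemiAnbd] Rmk. 3.1.1: profinite groups are tempered,
abc-iut-L3-t2 `IsTempered.of_profinite`). ([IUTchI] Def 3.1 (e) p.63) [claim: Mochizuki2012, status: disputed] -/
theorem isTempered_badPair_of_isClosed (hH : IsClosed ((B x hx).H : Set D.PiC)) : IsTempered ↥(B x hx).H :=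
  haveI : CompactSpace ↥(B x hx).H := isCompact_iff_compactSpace.mp hH.isCompact
  IsTempered.of_profinite

/-- **(vi)(a) at the merge record for a CLOSED avatar**, modulo `hΔ` only. ([IUTchI] Ex 3.2 (vi) (a) p.73) [claim: Mochizuki2012, status: disputed] -/
theorem ddashFromD_frobeniusBadAt_of_isClosed [Fact (D.primeAt x (D.not_mem_arc_of_mem_bad hx)).Prime]
    (hH : IsClosed ((B x hx).H : Set D.PiC))
    (hΔ : ∀ φ : ↥(B x hx).H ≃ₜ* ↥(B x hx).H, (I.m2 x hx).aug.ker.map φ.toMulEquiv.toMonoidHom = (I.m2 x hx).aug.ker) :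
    (D.frobeniusBadAt B I x hx).DdashFromD :=
  D.ddashFromD_frobeniusBadAt_of_forall_map_ker B I x hx (D.isTempered_badPair_of_isClosed B x hx hH) hΔ

/-- **(vi)(b) at the merge record** modulo {`hP`, `hΔ`, `hY`: `Π_Ÿ` carried to a conjugate of itself by every bicontinuous automorphism}:
`𝒟^Θ_v̲` is reconstructible category-theoretically from `𝒟_v̲` (p491087 `dThetaFromD_badLocalFrobenioidAt_of_forall_map_ker`, `T := I.m2 x hx`).
([IUTchI] Ex 3.2 (vi) (b) p.73) [claim: Mochizuki2012, status: disputed] -/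
theorem dThetaFromD_frobeniusBadAt_of_forall_map_ker [Fact (D.primeAt x (D.not_mem_arc_of_mem_bad hx)).Prime]
    (hP : IsTempered ↥(B x hx).H)
    (hΔ : ∀ φ : ↥(B x hx).H ≃ₜ* ↥(B x hx).H, (I.m2 x hx).aug.ker.map φ.toMulEquiv.toMonoidHom = (I.m2 x hx).aug.ker)
    (hY : ∀ φ : ↥(B x hx).H ≃ₜ* ↥(B x hx).H, ∃ c : ↥(B x hx).H, ∀ g : ↥(B x hx).H, g ∈ (I.m2 x hx).Y ↔ c⁻¹ * φ g * c ∈ (I.m2 x hx).Y) :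
    (D.frobeniusBadAt B I x hx).DThetaFromD :=
  haveI := D.liesOver_placeBelow x hx
  haveI := D.isScalarTower
  haveI := D.secondCountableTopology_badPair B I x hx
  letI := (I.m1 x hx).catFv; letI := (I.m1 x hx).catFbirat; letI := (I.m1 x hx).catCv
  D.dThetaFromD_badLocalFrobenioidAt_of_forall_map_ker (D.placeBelow_mem_VFbad x hx) (D.specAt x _) (D.primeAt x _)
    (D.primeAt_mem x _) (I.m2 x hx) (I.m1 x hx).Kt hP hΔ hY

/-- **(vi)(b) at the merge record for a CLOSED avatar**, modulo {`hΔ`, `hY`}. ([IUTchI] Ex 3.2 (vi) (b) p.73) [claim: Mochizuki2012, status: disputed] -/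
theorem dThetaFromD_frobeniusBadAt_of_isClosed [Fact (D.primeAt x (D.not_mem_arc_of_mem_bad hx)).Prime]
    (hH : IsClosed ((B x hx).H : Set D.PiC))
    (hΔ : ∀ φ : ↥(B x hx).H ≃ₜ* ↥(B x hx).H, (I.m2 x hx).aug.ker.map φ.toMulEquiv.toMonoidHom = (I.m2 x hx).aug.ker)
    (hY : ∀ φ : ↥(B x hx).H ≃ₜ* ↥(B x hx).H, ∃ c : ↥(B x hx).H, ∀ g : ↥(B x hx).H, g ∈ (I.m2 x hx).Y ↔ c⁻¹ * φ g * c ∈ (I.m2 x hx).Y) :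
    (D.frobeniusBadAt B I x hx).DThetaFromD :=
  D.dThetaFromD_frobeniusBadAt_of_forall_map_ker B I x hx (D.isTempered_badPair_of_isClosed B x hx hH) hΔ hY

/-- **Ex. 3.2 (vi)(a)(b)(c) JOINTLY at the merge record** for a closed avatar, modulo exactly {`hΔ`, `hY`} — the by-name closer the
re-pointed tokens cite. ([IUTchI] Ex 3.2 (vi) p.73) [claim: Mochizuki2012, status: disputed] -/
theorem ex32vi_abc_frobeniusBadAt_of_isClosed [Fact (D.primeAt x (D.not_mem_arc_of_mem_bad hx)).Prime]
    (hH : IsClosed ((B x hx).H : Set D.PiC))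
    (hΔ : ∀ φ : ↥(B x hx).H ≃ₜ* ↥(B x hx).H, (I.m2 x hx).aug.ker.map φ.toMulEquiv.toMonoidHom = (I.m2 x hx).aug.ker)
    (hY : ∀ φ : ↥(B x hx).H ≃ₜ* ↥(B x hx).H, ∃ c : ↥(B x hx).H, ∀ g : ↥(B x hx).H, g ∈ (I.m2 x hx).Y ↔ c⁻¹ * φ g * c ∈ (I.m2 x hx).Y) :
    (D.frobeniusBadAt B I x hx).DdashFromD ∧ (D.frobeniusBadAt B I x hx).DThetaFromD ∧ (D.frobeniusBadAt B I x hx).BasesFromC :=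
  ⟨D.ddashFromD_frobeniusBadAt_of_isClosed B I x hx hH hΔ, D.dThetaFromD_frobeniusBadAt_of_isClosed B I x hx hH hΔ hY,
    D.basesFromC_frobeniusBadAt B I x hx⟩

end InitialThetaData

end Literature.IUT.HodgeTheaters

end
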